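import Mathlib

/-!
# Tropical links, inductive step: weights from a valuation (brick W)

Route `ResolutionOfSingularities/TropicalLinks`, crux `InductiveStep`
(stmt-ResolutionOfSingularities-17233), line `split`, brick W of the valuative layer.

Let `𝒪' := k[ℤ × K] ⧸ J`, write `x w := [single w 1]` for the monomials and `x₁ := x (1, 0)` for the
ray, and let `(A, ιA, m, a)` be a stratum chart: `x w * m ^ (a w)⁻ = ε * m ^ (a w)⁺` with `ε` a
unit of `A`, `a` surjective onto `ℤ ^ l`.  If `v` is a valuation on `𝒪'` with `v ∘ ιA ≤ 1`,
`v (ιA (m i)) < 1` for all `i`, trivial on the `K`-torus and with `v x₁ < 1`, then the ray is a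
positive integer combination of the boundary orders: `w.1 = ∑ i, b i * a w i` with all `b i > 0`.

Proof: `v (x w) = γ ^ w.1` with `γ := v x₁ ∈ (0, 1)`; units of `A` have value `1`; applying `v`
to the chart identity at a preimage `u i` of the `i`-th basis vector gives
`v (ιA (m i)) = γ ^ (u i).1`, whence `0 < (u i).1`, and at a general `w` the injectivity of
`n ↦ γ ^ n` gives the claim with `b i := (u i).1`.
-/

set_option linter.dupNamespace false

namespace Summit.ResolutionOfSingularities.ResolutionOfSingularities.Theorems

/-- For `n : ℕ` the monomial `[single (n, 0) 1]` of `k[ℤ × K] ⧸ J` is the `n`-th power of the ray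
`x₁ = [single (1, 0) 1]`. [folklore] -/
theorem tropicalLinks_mk_single_natCast_eq_pow (k : Type) [Field k] (K : Type) [AddCommGroup K]
    (J : Ideal (AddMonoidAlgebra k (ℤ × K))) (n : ℕ) :
    Ideal.Quotient.mk J (AddMonoidAlgebra.single (((n : ℤ)), (0 : K)) (1 : k)) =
      Ideal.Quotient.mk J (AddMonoidAlgebra.single ((1 : ℤ), (0 : K)) (1 : k)) ^ n := by
  induction n with
  | zero =>
    rw [pow_zero, ← map_one (Ideal.Quotient.mk J), AddMonoidAlgebra.one_def, Nat.cast_zero,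
      Prod.mk_zero_zero]
  | succ n ih =>
    rw [pow_succ, ← ih, ← map_mul, AddMonoidAlgebra.single_mul_single, mul_one, Prod.mk_add_mk,
      add_zero, Nat.cast_succ]

/-- The monomials `[single (n, 0) 1]` and `[single (-n, 0) 1]` of `k[ℤ × K] ⧸ J` are mutually
inverse. [folklore] -/
theorem tropicalLinks_mk_single_mul_mk_single_neg (k : Type) [Field k] (K : Type)
    [AddCommGroup K] (J : Ideal (AddMonoidAlgebra k (ℤ × K))) (n : ℤ) :
    Ideal.Quotient.mk J (AddMonoidAlgebra.single ((n, (0 : K))) (1 : k)) *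
      Ideal.Quotient.mk J (AddMonoidAlgebra.single ((-n, (0 : K))) (1 : k)) = 1 := by
  rw [← map_mul, AddMonoidAlgebra.single_mul_single, mul_one, Prod.mk_add_mk, add_neg_cancel,
    add_zero, Prod.mk_zero_zero, ← AddMonoidAlgebra.one_def, map_one]

/-- Values of monomials under a valuation trivial on the `K`-torus: the value `γ` of the ray
`[single (1, 0) 1]` is non-zero and `v [single w 1] = γ ^ w.1`. [folklore] -/
theorem tropicalLinks_val_mk_single_eq_zpow (k : Type) [Field k] (K : Type) [AddCommGroup K]
    (J : Ideal (AddMonoidAlgebra k (ℤ × K))) (Γ₀ : Type) [LinearOrderedCommGroupWithZero Γ₀]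
    (v : Valuation (AddMonoidAlgebra k (ℤ × K) ⧸ J) Γ₀)
    (hK : ∀ κ : K, v (Ideal.Quotient.mk J (AddMonoidAlgebra.single ((0 : ℤ), κ) (1 : k))) = 1)
    (w : ℤ × K) :
    v (Ideal.Quotient.mk J (AddMonoidAlgebra.single ((1 : ℤ), (0 : K)) (1 : k))) ≠ 0 ∧
      v (Ideal.Quotient.mk J (AddMonoidAlgebra.single w (1 : k))) =
        v (Ideal.Quotient.mk J (AddMonoidAlgebra.single ((1 : ℤ), (0 : K)) (1 : k))) ^ w.1 := by
  -- non-negative powers of the ray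
  have hnat : ∀ n : ℕ,
      v (Ideal.Quotient.mk J (AddMonoidAlgebra.single (((n : ℤ)), (0 : K)) (1 : k))) =
        v (Ideal.Quotient.mk J (AddMonoidAlgebra.single ((1 : ℤ), (0 : K)) (1 : k))) ^ n :=
    fun n => by rw [tropicalLinks_mk_single_natCast_eq_pow, map_pow]
  -- inverse pairs
  have hinv : ∀ n : ℤ, v (Ideal.Quotient.mk J (AddMonoidAlgebra.single ((n, (0 : K))) (1 : k))) *
      v (Ideal.Quotient.mk J (AddMonoidAlgebra.single ((-n, (0 : K))) (1 : k))) = 1 := fun n => by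
    rw [← map_mul, tropicalLinks_mk_single_mul_mk_single_neg, map_one]
  refine ⟨left_ne_zero_of_mul_eq_one (hinv 1), ?_⟩
  -- split off the torus part
  have hsplit : AddMonoidAlgebra.single w (1 : k) =
      AddMonoidAlgebra.single ((w.1, (0 : K))) (1 : k) *
        AddMonoidAlgebra.single (((0 : ℤ), w.2)) (1 : k) := by
    rw [AddMonoidAlgebra.single_mul_single, mul_one, Prod.mk_add_mk, add_zero, zero_add]
  rw [hsplit, map_mul, map_mul, hK, mul_one]
  obtain ⟨n, hn | hn⟩ := Int.eq_nat_or_neg w.1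
  · rw [hn, hnat, zpow_natCast]
  · have h := hinv (-(n : ℤ))
    rw [neg_neg, hnat] at h
    rw [hn, eq_inv_of_mul_eq_one_left h, zpow_neg, zpow_natCast]

/-- **Brick W** (weights from a valuation).  For a stratum chart `(A, ιA, m, a)` of
`k[ℤ × K] ⧸ J` and a valuation `v` centred on the stratum (`v ∘ ιA ≤ 1`, `v (ιA (m i)) < 1`),
trivial on the `K`-torus and centred on the special fibre (`v [single (1, 0) 1] < 1`), the ray is a
positive integer combination of the boundary orders: `w.1 = ∑ i, b i * a w i` with `0 < b i`.
[folklore] -/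
theorem tropicalLinks_exists_weights_of_valuation : ∀ (k : Type) [Field k] (K : Type) [AddCommGroup K] (J : Ideal (AddMonoidAlgebra k (ℤ × K))) (A : Type) [CommRing A] [Algebra k A] (ιA : A →ₐ[k] AddMonoidAlgebra k (ℤ × K) ⧸ J) (l : ℕ) (m : Fin l → A) (a : (ℤ × K) →+ (Fin l → ℤ)), Function.Surjective a → (∀ w : ℤ × K, ∃ ε : Aˣ, Ideal.Quotient.mk J (AddMonoidAlgebra.single w (1 : k)) * ιA (∏ i, m i ^ (-(a w i)).toNat) = ιA ((ε : A) * ∏ i, m i ^ (a w i).toNat)) → ∀ (Γ₀ : Type) [LinearOrderedCommGroupWithZero Γ₀] (v : Valuation (AddMonoidAlgebra k (ℤ × K) ⧸ J) Γ₀), (∀ x : A, v (ιA x) ≤ 1) → (∀ i, v (ιA (m i)) < 1) → (∀ κ : K, v (Ideal.Quotient.mk J (AddMonoidAlgebra.single ((0 : ℤ), κ) (1 : k))) = 1) → v (Ideal.Quotient.mk J (AddMonoidAlgebra.single ((1 : ℤ), (0 : K)) (1 : k))) < 1 → ∃ b : Fin l → ℕ, (∀ i, 0 < b i) ∧ ∀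 w : ℤ × K, w.1 = ∑ i, (b i : ℤ) * a w i := by
  intro k _ K _ J A _ _ ιA l m a ha hmon Γ₀ _ v hA hm hK hx1
  -- units of `A` have value `1`
  have hunit : ∀ ε : Aˣ, v (ιA (ε : A)) = 1 := fun ε => by
    have h2 := hA ((ε⁻¹ : Aˣ) : A)
    have h3 : v (ιA (ε : A)) * v (ιA ((ε⁻¹ : Aˣ) : A)) = 1 := by
      rw [← map_mul, ← map_mul, Units.mul_inv, map_one, map_one]
    refine le_antisymm (hA (ε : A)) ?_
    calc (1 : Γ₀) = v (ιA (ε : A)) * v (ιA ((ε⁻¹ : Aˣ) : A)) := h3.symm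
      _ ≤ v (ιA (ε : A)) * 1 := mul_le_mul_right h2 _
      _ = v (ιA (ε : A)) := mul_one _
  -- the value `γ` of the ray and the values of the monomials
  set γ : Γ₀ := v (Ideal.Quotient.mk J (AddMonoidAlgebra.single ((1 : ℤ), (0 : K)) (1 : k)))
    with hγ
  have hγ1 : γ < 1 := hx1
  have hγ0 : γ ≠ 0 := (tropicalLinks_val_mk_single_eq_zpow k K J Γ₀ v hK 0).1
  have hγpos : 0 < γ := zero_lt_iff.mpr hγ0
  have hval : ∀ w : ℤ × K,
      v (Ideal.Quotient.mk J (AddMonoidAlgebra.single w (1 : k))) = γ ^ w.1 :=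
    fun w => (tropicalLinks_val_mk_single_eq_zpow k K J Γ₀ v hK w).2
  -- apply `v` to the chart identity
  have hμ : ∀ w : ℤ × K, γ ^ w.1 * ∏ i, v (ιA (m i)) ^ (-(a w i)).toNat =
      ∏ i, v (ιA (m i)) ^ (a w i).toNat := fun w => by
    obtain ⟨ε, hε⟩ := hmon w
    have h := congrArg v hε
    simp only [map_mul, map_prod, map_pow, hunit, one_mul, hval] at h
    exact h
  -- preimages of the basis vectors of `ℤ ^ l`
  choose u hu using fun i => ha (Pi.single i 1)
  have hμi : ∀ i, v (ιA (m i)) = γ ^ (u i).1 := fun i => by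
    have h := hμ (u i)
    have h1 : ∀ j, v (ιA (m j)) ^ (-(a (u i) j)).toNat = 1 := fun j => by
      rw [hu i]
      by_cases hj : j = i
      · subst hj; simp
      · simp [hj]
    have h2 : ∀ j, v (ιA (m j)) ^ (a (u i) j).toNat = if j = i then v (ιA (m j)) else 1 :=
      fun j => by
      rw [hu i]
      by_cases hj : j = i
      · subst hj; simp
      · simp [hj]
    simp only [h1, h2, Finset.prod_const_one, mul_one, Finset.prod_ite_eq', Finset.mem_univ,
      if_true] at h
    exact h.symm
  -- positivity of the exponents
  have hβpos : ∀ i, 0 < (u i).1 := fun i => by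
    have h := hm i
    rw [hμi i] at h
    exact (zpow_lt_one_iff_right_of_lt_one₀ hγpos hγ1).1 h
  refine ⟨fun i => ((u i).1).toNat, fun i => ?_, fun w => ?_⟩
  · have := hβpos i
    show 0 < ((u i).1).toNat
    omega
  · have hb : ∀ i, ((((u i).1).toNat : ℕ) : ℤ) = (u i).1 := fun i =>
      Int.toNat_of_nonneg (hβpos i).le
    have hμn : ∀ i, v (ιA (m i)) = γ ^ ((u i).1).toNat := fun i => by
      rw [hμi i, ← zpow_natCast, hb i]
    have h := hμ w
    simp only [hμn, ← pow_mul, Finset.prod_pow_eq_pow_sum] at h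
    rw [← zpow_natCast, ← zpow_natCast, ← zpow_add₀ hγ0] at h
    have hinj := zpow_right_injective₀ hγpos hγ1.ne h
    push_cast at hinj
    calc
      w.1 = ∑ i, ((((u i).1).toNat : ℕ) : ℤ) * (((a w i).toNat : ℕ) : ℤ) -
          ∑ i, ((((u i).1).toNat : ℕ) : ℤ) * (((-(a w i)).toNat : ℕ) : ℤ) := by
        linear_combination hinj
      _ = ∑ i, ((((u i).1).toNat : ℕ) : ℤ) * a w i := by
        rw [← Finset.sum_sub_distrib]
        refine Finset.sum_congr rfl fun i _ => ?_
        rw [← mul_sub, Int.toNat_sub_toNat_neg]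

end Summit.ResolutionOfSingularities.ResolutionOfSingularities.Theorems
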